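import Mathlib
import Literature.NumberTheory.Automorphic.FuchsianCollars
import Literature.NumberTheory.Automorphic.FuchsianCuspZones

/-!
# The compact core of a finite volume Fuchsian group (Siegel's theorem, thick–thin form)
(Iwaniec, *Spectral Methods of Automorphic Forms*, GSM 53, §2.2, Prop. 2.3–2.5 and (2.1)–(2.5),
PDF pp. 28–31; Beardon, *The Geometry of Discrete Groups*, GTM 91, Thm 5.4.1)

Sixth brick of the theory of a GENERAL discrete `Γ ≤ SL₂(ℝ)` and the assembly of the thick–thin
route (`FuchsianTorsion`, `FuchsianCollars`, `FuchsianCuspZones`): **if `Γ ∋ -1` is discrete with a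
measurable fundamental domain of finite hyperbolic area, then there is a compact `K ⊂ ℍ` such that
every point of `ℍ` is `Γ`-equivalent to a point of `K` or of one of the cuspidal zones
`σ_𝔞{Im z > 1}` of a complete system of inequivalent cusps** (`exists_compact_core`). This is the
geometric content of Iwaniec's standing assumption "Fuchsian group of the first kind" in the form
used by the spectral theory (Prop. 2.3: finite volume ⇒ first kind and finitely generated; (2.5):
`F = F(Y) ∪ ⋃ F_𝔞(Y)` with `F(Y)` compact), stated in the book without proof.

Everything is proved; nothing is vendored; no fact is introduced.

1. (§1) Displacements: a hyperbolic element moves every point by `u ≥ (tr² - 4)/4`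
   (`traceSq_sub_four_le_pointPairInv`); an elliptic element (`tr² < 4`) has a fixed point in `ℍ`
   (`exists_smul_eq_self_of_traceSq_lt_four`); `tr[A,B] - 2 = (4 - tr²A) u(Bp, p)` for `A` fixing
   `p` (`trace_comm_sub_two_of_smul_eq`); **two elliptic elements moving a point little share their
   fixed point when `Γ` has a positive systole** (`fixedPoint_eq_of_small_displacement`: otherwise
   their commutator is a short hyperbolic element); a non-central element with `tr² = 4` is parabolic
   (`isParabolic_of_traceSq_eq_four`), and **a parabolic element moving `z` by `u < 1/4` puts a
   `Γ`-translate of `z` in `σ_i{Im > 1}`** (`exists_smul_mem_cusp_of_parabolic`, with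
   `u(z, z + n) = n²/4y²`, `pointPairInv_vadd`).
2. (§2) Thick points (`IsThick`: every parabolic element moves them by `u ≥ 1/4`) have bounded local
   multiplicity: for an admissible radius `ρ` (`IsAdmissibleRadius`, e.g. `min(1/8, η/1200)`), the
   elements moving a thick `z` by `u ≤ ρ` lie in one stabiliser `Γ_p`
   (`small_displacement_subset_stabiliser`), hence number `≤ M` (`ncard_small_displacement_le`,
   `M` from `FuchsianTorsion.exists_stabiliser_ncard_le`, `η` from
   `FuchsianCollars.exists_pos_le_traceSq_sub_four`).
3. (§3) Packing: for pairwise `ρ`-separated thick points the weight `Σ_i M⁻¹𝟙_{B(p_i,r)}`,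
   `4r(1+r) ≤ ρ`, has `Σ_γ φ(γw) ≤ 1` (`tsum_thickWeight_le_one`), so `2N·4πr ≤ M|F|` by unfolding
   (`card_separated_le`).
4. (§4) `exists_compact_core` and the packaged `exists_cuspSystem_and_compact_core`.

## References
* [Iwaniec2002] H. Iwaniec, *Spectral Methods of Automorphic Forms*, 2nd ed., GSM 53, AMS 2002,
  §2.2, PDF pp. 28–31.
* [Beardon1983] A. F. Beardon, *The Geometry of Discrete Groups*, GTM 91, Springer 1983, Thm 5.4.1.
* [Jorgensen1976] T. Jørgensen, On discrete groups of Möbius transformations, Amer. J. Math. 98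
  (1976), 739–749, Lemma 1.

Mathlib: `Matrix.GeneralLinearGroup.IsParabolic`, `parabolicFixedPoint`, `IsParabolic.smul_eq_self_iff`,
`Matrix.discr_fin_two`, `IsCusp`, `Nat.findGreatest`, `isCompact_closedBall` (`ProperSpace ℍ`).
Literature: `exists_stabiliser_ncard_le`, `uDisc`, `le_pointPairInv_of_smul_ne` (`FuchsianTorsion`);
`exists_pos_le_traceSq_sub_four`, `exists_conj_diag`, `pointPairInv_diag_smul` (`FuchsianCollars`);
`exists_cuspSystem`, `conj_eq_upperRightHom_of_smul_eq`, `upperRightHom_smul` (`FuchsianCuspZones`);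
`trace_comm_sub_two_eq`, `conj_smul_I_eq`, `four_mul_pointPairInv_add_two`, `pointPairInv_eq_zero_iff`
(`JorgensenInequality`); `eq_one_or_neg_one_of_fixed_two`, `setLIntegral_tsum_smul_eq`
(`FundamentalDomainUnfolding`); `pointPairInv_le_of_le_of_le` (`LocalWeylLaw`). Nothing on compact
cores / Siegel's theorem for general Fuchsian groups existed (`lean search 'Siegel|compact core|first kind'`;
the tree's `volume_modularSiegel_lt_top` is the `SL₂(ℤ)` case only).
-/

noncomputable section

namespace Literature.NumberTheory.Automorphic

namespace Fuchsian

open Matrix UpperHalfPlane _root_.MeasureTheory _root_.Set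
open scoped _root_.MatrixGroups _root_.Pointwise _root_.ENNReal _root_.NNReal _root_.Real

variable {Γ : Subgroup (GL (Fin 2) ℝ)} {F : Set ℍ}

/-! ## 1. Displacements of hyperbolic, elliptic and parabolic elements -/

section Displacement

/-- **A hyperbolic element moves every point by at least its translation length**:
`u(z, γz) ≥ (tr²γ - 4)/4 = sinh²(ℓ/2)`. [cite: Iwaniec2002, §1.5, PDF pp. 19–20] -/
theorem traceSq_sub_four_le_pointPairInv (γ : SL(2, ℝ)) (hγ : 4 < (γ 0 0 + γ 1 1) ^ 2) (z : ℍ) :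
    ((γ 0 0 + γ 1 1) ^ 2 - 4) / 4 ≤ pointPairInv z (γ • z) := by
  obtain ⟨g, h01, h10, hl⟩ := exists_conj_diag γ hγ
  set D := g⁻¹ * γ * g with hD
  have htr : D 0 0 + D 1 1 = γ 0 0 + γ 1 1 := trace_conj_eq g γ
  have hγD : γ = g * D * g⁻¹ := by rw [hD]; group
  have e : pointPairInv z (γ • z) = pointPairInv (g⁻¹ • z) (D • (g⁻¹ • z)) := by
    conv_lhs => rw [hγD, mul_smul, mul_smul, ← pointPairInv_smul g⁻¹, inv_smul_smul]
  rw [e, pointPairInv_diag_smul h01 h10, htr]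
  have hμ : 0 ≤ (γ 0 0 + γ 1 1) ^ 2 - 4 := by linarith
  have : 0 ≤ ((γ 0 0 + γ 1 1) ^ 2 - 4) * ((g⁻¹ • z).re / (g⁻¹ • z).im) ^ 2 := by positivity
  linarith

/-- **An elliptic element has a fixed point in `ℍ`**: if `tr²γ < 4` then `γp = p` for
`p = ((a - d) + i√(4 - tr²γ))/(2c)` (after replacing `γ` by `-γ` to have `c > 0`).
[cite: Iwaniec2002, §1.5, PDF pp. 19–20] -/
theorem exists_smul_eq_self_of_traceSq_lt_four (γ : SL(2, ℝ)) (hγ : (γ 0 0 + γ 1 1) ^ 2 < 4) :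
    ∃ p : ℍ, γ • p = p := by
  -- reduce to `c > 0` using `(-γ) • z = γ • z`
  suffices key : ∀ δ : SL(2, ℝ), (δ 0 0 + δ 1 1) ^ 2 < 4 → 0 < δ 1 0 → ∃ p : ℍ, δ • p = p by
    have hdet := det_rel γ
    have hc : γ 1 0 ≠ 0 := by
      intro hc
      rw [hc, mul_zero, sub_zero] at hdet
      nlinarith [sq_nonneg (γ 0 0 - γ 1 1)]
    rcases lt_or_gt_of_ne hc with h | h
    · obtain ⟨p, hp⟩ := key (-γ) (by simpa [Matrix.SpecialLinearGroup.coe_neg] using by nlinarith)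
        (by simp [Matrix.SpecialLinearGroup.coe_neg]; linarith)
      refine ⟨p, ?_⟩
      have e : (-γ) • p = γ • p := by
        show (Matrix.SpecialLinearGroup.toGL (-γ) : GL (Fin 2) ℝ) • p =
          (Matrix.SpecialLinearGroup.toGL γ : GL (Fin 2) ℝ) • p
        rw [toGL_neg, UpperHalfPlane.neg_smul]
      rwa [e] at hp
    · exact key γ hγ h
  intro δ hδ hc
  have hdet := det_rel δ
  set S : ℝ := Real.sqrt (4 - (δ 0 0 + δ 1 1) ^ 2) with hS
  have hS0 : 0 < S := Real.sqrt_pos.mpr (by linarith)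
  have hS2 : S ^ 2 = 4 - (δ 0 0 + δ 1 1) ^ 2 := Real.sq_sqrt (by linarith)
  set pc : ℂ := ((δ 0 0 - δ 1 1 : ℝ) + S * Complex.I) / (2 * δ 1 0 : ℝ) with hpc
  have hpim : 0 < pc.im := by
    rw [hpc, Complex.div_ofReal_im]
    simp only [Complex.add_im, Complex.ofReal_im, Complex.mul_im, Complex.ofReal_re, Complex.I_im, mul_one,
      Complex.I_re, mul_zero, add_zero, zero_add]
    positivity
  refine ⟨⟨pc, hpim⟩, ?_⟩
  apply UpperHalfPlane.ext
  rw [UpperHalfPlane.coe_specialLinearGroup_apply]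
  simp only [Algebra.algebraMap_self, RingHom.id_apply]
  have hden : (δ 1 0 : ℂ) * pc + δ 1 1 ≠ 0 := by
    intro h
    have := congrArg Complex.im h
    simp only [Complex.add_im, Complex.mul_im, Complex.ofReal_re, Complex.ofReal_im, zero_mul, add_zero,
      Complex.zero_im] at this
    have : δ 1 0 * pc.im = 0 := this
    rcases mul_eq_zero.mp this with h' | h'
    · exact hc.ne' h'
    · exact hpim.ne' h'
  rw [div_eq_iff hden]
  -- the fixed point equation `c p² + (d - a) p - b = 0`
  have hc' : ((2 * δ 1 0 : ℝ) : ℂ) ≠ 0 := by exact_mod_cast (by positivity : (2 * δ 1 0 : ℝ) ≠ 0)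
  have hI : Complex.I * Complex.I = -1 := Complex.I_mul_I
  have hS2c : (S : ℂ) ^ 2 = 4 - ((δ 0 0 : ℂ) + δ 1 1) ^ 2 := by exact_mod_cast hS2
  have hdetc : (δ 0 0 : ℂ) * δ 1 1 - δ 0 1 * δ 1 0 = 1 := by exact_mod_cast hdet
  rw [hpc]
  field_simp
  push_cast
  linear_combination (-(δ 1 0 : ℂ) * (S : ℂ) ^ 2) * hI + (δ 1 0 : ℂ) * hS2c + (-(4 : ℂ) * δ 1 0) * hdetc

/-- **Trace of the commutator with an elliptic element**: if `A` fixes `p ∈ ℍ` then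
`tr[A, B] - 2 = (4 - tr²A) u(Bp, p)`. [cite: Jorgensen1976, proof of Lemma 1] -/
theorem trace_comm_sub_two_of_smul_eq {A : SL(2, ℝ)} {p : ℍ}
    (hAp : (Matrix.SpecialLinearGroup.toGL A : GL (Fin 2) ℝ) • p = p) (B : SL(2, ℝ)) :
    (A * B * A⁻¹ * B⁻¹) 0 0 + (A * B * A⁻¹ * B⁻¹) 1 1 - 2 =
      (4 - (A 0 0 + A 1 1) ^ 2) * pointPairInv ((Matrix.SpecialLinearGroup.toGL B : GL (Fin 2) ℝ) • p) p := by
  have ee : ∀ (x : SL(2, ℝ)) (z : ℍ), (Matrix.SpecialLinearGroup.toGL x : GL (Fin 2) ℝ) • z = x • z :=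
    fun x z => rfl
  obtain ⟨g, hg⟩ := MulAction.exists_smul_eq SL(2, ℝ) I p
  have hA'I := conj_smul_I_eq hg hAp
  set A' := g⁻¹ * A * g with hA'
  set B' := g⁻¹ * B * g with hB'
  have hcomm : A' * B' * A'⁻¹ * B'⁻¹ = g⁻¹ * (A * B * A⁻¹ * B⁻¹) * g := by rw [hA', hB']; group
  have htr : (A' * B' * A'⁻¹ * B'⁻¹) 0 0 + (A' * B' * A'⁻¹ * B'⁻¹) 1 1 =
      (A * B * A⁻¹ * B⁻¹) 0 0 + (A * B * A⁻¹ * B⁻¹) 1 1 := by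
    rw [hcomm]; exact trace_conj_eq g _
  have htrA : A' 0 0 + A' 1 1 = A 0 0 + A 1 1 := trace_conj_eq g A
  have h1 := trace_comm_sub_two_eq hA'I B'
  rw [htr] at h1
  rw [h1, ← four_mul_pointPairInv_add_two B']
  have hμ : 4 - (A 0 0 + A 1 1) ^ 2 = 4 * A' 1 0 ^ 2 := by
    rw [← htrA]; have := trace_sq_sub_four_of_smul_I hA'I; linarith
  rw [hμ]
  have hu : pointPairInv ((Matrix.SpecialLinearGroup.toGL B' : GL (Fin 2) ℝ) • I) I =
      pointPairInv ((Matrix.SpecialLinearGroup.toGL B : GL (Fin 2) ℝ) • p) p := by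
    rw [ee, ee, hB', mul_smul, mul_smul, ← hg, ← pointPairInv_smul g⁻¹ (B • g • I) (g • I), inv_smul_smul]
  rw [hu]
  ring

/-- Displacement is symmetric under inversion: `u(z, A⁻¹z) = u(z, Az)`. [folklore] -/
theorem pointPairInv_inv_smul (A : SL(2, ℝ)) (z : ℍ) : pointPairInv z (A⁻¹ • z) = pointPairInv z (A • z) := by
  conv_lhs => rw [← pointPairInv_smul A, smul_inv_smul, pointPairInv_comm]

/-- Displacements compose: `u(z, ABz) ≤ 4δ(1 + δ)` if `u(z, Az), u(z, Bz) ≤ δ`. [folklore] -/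
theorem pointPairInv_mul_smul_le {A B : SL(2, ℝ)} {z : ℍ} {δ : ℝ} (hδ : 0 ≤ δ)
    (hA : pointPairInv z (A • z) ≤ δ) (hB : pointPairInv z (B • z) ≤ δ) :
    pointPairInv z ((A * B) • z) ≤ 4 * δ * (1 + δ) := by
  have h1 : pointPairInv (A • z) z ≤ δ := by rw [pointPairInv_comm]; exact hA
  have h2 : pointPairInv (A • z) ((A * B) • z) ≤ δ := by rw [mul_smul, pointPairInv_smul]; exact hB
  exact pointPairInv_le_of_le_of_le hδ h1 h2

/-- **Two elliptic elements with small displacements at a common point share their fixed point**,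
given a positive systole `η`: otherwise the commutator `[A₁, A₂] ∈ Γ` is hyperbolic
(`tr[A₁,A₂] - 2 = (4 - tr²A₁) u(A₂p₁, p₁) > 0`), of displacement `≥ η/4` everywhere, but it moves
`z` by at most `4δ'(1+δ')`, `δ' = 4δ(1+δ)`. [cite: Beardon1983, Thm 5.4.1] -/
theorem fixedPoint_eq_of_small_displacement
    (hΓ : Γ ≤ (Matrix.SpecialLinearGroup.toGL : SL(2, ℝ) →* GL (Fin 2) ℝ).range)
    (hd : IsDiscreteSubgroup Γ) {η : ℝ}
    (hη : ∀ γ ∈ Γ, 4 < ((γ 0 0 : ℝ) + γ 1 1) ^ 2 → η ≤ ((γ 0 0 : ℝ) + γ 1 1) ^ 2 - 4)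
    {A₁ A₂ : SL(2, ℝ)} (h₁ : (Matrix.SpecialLinearGroup.toGL A₁ : GL (Fin 2) ℝ) ∈ Γ)
    (h₂ : (Matrix.SpecialLinearGroup.toGL A₂ : GL (Fin 2) ℝ) ∈ Γ) {p₁ p₂ : ℍ}
    (hp₁ : (Matrix.SpecialLinearGroup.toGL A₁ : GL (Fin 2) ℝ) • p₁ = p₁)
    (hp₂ : (Matrix.SpecialLinearGroup.toGL A₂ : GL (Fin 2) ℝ) • p₂ = p₂)
    (hA₁ : A₁ ≠ 1) (hA₁' : A₁ ≠ -1) (hA₂ : A₂ ≠ 1) (hA₂' : A₂ ≠ -1)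
    {z : ℍ} {δ : ℝ} (hδ : 0 ≤ δ) (hd₁ : pointPairInv z (A₁ • z) ≤ δ) (hd₂ : pointPairInv z (A₂ • z) ≤ δ)
    (hsmall : 4 * (4 * δ * (1 + δ)) * (1 + 4 * δ * (1 + δ)) < η / 4) : p₁ = p₂ := by
  have ee : ∀ (x : SL(2, ℝ)) (z : ℍ), (Matrix.SpecialLinearGroup.toGL x : GL (Fin 2) ℝ) • z = x • z :=
    fun x z => rfl
  by_contra hne
  -- `A₂` moves `p₁`
  have hmove : (Matrix.SpecialLinearGroup.toGL A₂ : GL (Fin 2) ℝ) • p₁ ≠ p₁ := by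
    intro hfix
    rcases eq_one_or_neg_one_of_fixed_two ⟨A₂, rfl⟩ hne hfix hp₂ with h | h
    · exact hA₂ (Matrix.SpecialLinearGroup.toGL_injective (by rw [h, map_one]))
    · exact hA₂' (Matrix.SpecialLinearGroup.toGL_injective (by rw [h, toGL_neg, map_one]))
  obtain ⟨hμ₁, -⟩ := le_pointPairInv_of_smul_ne hΓ hd h₁ hp₁ hA₁ hA₁' h₂ hmove
  have hu : 0 < pointPairInv ((Matrix.SpecialLinearGroup.toGL A₂ : GL (Fin 2) ℝ) • p₁) p₁ := by
    rcases (pointPairInv_nonneg _ _).lt_or_eq with h | h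
    · exact h
    · exact absurd ((pointPairInv_eq_zero_iff _ _).mp h.symm) hmove
  -- the commutator is hyperbolic
  set C : SL(2, ℝ) := A₁ * A₂ * A₁⁻¹ * A₂⁻¹ with hC
  have htrC : 2 < C 0 0 + C 1 1 := by
    have := trace_comm_sub_two_of_smul_eq hp₁ A₂
    rw [← hC] at this
    nlinarith [mul_pos hμ₁ hu]
  have hC4 : 4 < (C 0 0 + C 1 1) ^ 2 := by nlinarith
  have hCmem : (Matrix.SpecialLinearGroup.toGL C : GL (Fin 2) ℝ) ∈ Γ := by
    rw [hC, map_mul, map_mul, map_mul, map_inv, map_inv]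
    exact Γ.mul_mem (Γ.mul_mem (Γ.mul_mem h₁ h₂) (Γ.inv_mem h₁)) (Γ.inv_mem h₂)
  have hηC := hη _ hCmem hC4
  have eC : ∀ i j, ((Matrix.SpecialLinearGroup.toGL C : GL (Fin 2) ℝ) i j : ℝ) = C i j := fun i j => rfl
  simp only [eC] at hηC
  -- displacement of `C` at `z`: at least `η/4`, at most `δ''`
  have hlow := traceSq_sub_four_le_pointPairInv C hC4 z
  have hX : pointPairInv z ((A₁ * A₂) • z) ≤ 4 * δ * (1 + δ) := pointPairInv_mul_smul_le hδ hd₁ hd₂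
  have hY : pointPairInv z ((A₁⁻¹ * A₂⁻¹) • z) ≤ 4 * δ * (1 + δ) :=
    pointPairInv_mul_smul_le hδ (by rw [pointPairInv_inv_smul]; exact hd₁)
      (by rw [pointPairInv_inv_smul]; exact hd₂)
  have hXY := pointPairInv_mul_smul_le (by positivity) hX hY
  have eC' : A₁ * A₂ * (A₁⁻¹ * A₂⁻¹) = C := by rw [hC]; group
  rw [eC'] at hXY
  linarith

/-- Displacement of a real translation: `u(z, z + x) = x²/(4 (Im z)²)`. [cite: Iwaniec2002, (1.3), PDF p. 9] -/
theorem pointPairInv_vadd (x : ℝ) (z : ℍ) : pointPairInv z (x +ᵥ z) = x ^ 2 / (4 * z.im ^ 2) := by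
  rw [pointPairInv, Complex.dist_eq, Complex.sq_norm, Complex.normSq_apply]
  simp only [Complex.sub_re, Complex.sub_im, UpperHalfPlane.coe_re, UpperHalfPlane.coe_im, UpperHalfPlane.vadd_re,
    UpperHalfPlane.vadd_im]
  ring_nf

/-- A non-central element of `Γ ≤ SL₂(ℝ)` with `tr² = 4` is parabolic. [cite: Iwaniec2002, §1.5, PDF pp. 19–20] -/
theorem isParabolic_of_traceSq_eq_four {γ : GL (Fin 2) ℝ}
    (hγ : γ ∈ (Matrix.SpecialLinearGroup.toGL : SL(2, ℝ) →* GL (Fin 2) ℝ).range)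
    (h1 : γ ≠ 1) (h2 : γ ≠ -1) (htr : ((γ 0 0 : ℝ) + γ 1 1) ^ 2 = 4) : γ.IsParabolic := by
  obtain ⟨g, rfl⟩ := hγ
  have e : ∀ i j, ((Matrix.SpecialLinearGroup.toGL g : GL (Fin 2) ℝ) i j : ℝ) = g i j := fun i j => rfl
  simp only [e] at htr
  have hdet := det_rel g
  refine ⟨?_, ?_⟩
  · rintro ⟨t, ht⟩
    have hval : ∀ i j, (Matrix.scalar (Fin 2) t) i j = g i j := fun i j => by
      rw [ht]; rfl
    have h00 : g 0 0 = t := by rw [← hval 0 0]; simp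
    have h11 : g 1 1 = t := by rw [← hval 1 1]; simp
    have h01 : g 0 1 = 0 := by rw [← hval 0 1]; simp
    have h10 : g 1 0 = 0 := by rw [← hval 1 0]; simp
    rw [h00, h11, h01, zero_mul, sub_zero] at hdet
    rcases mul_self_eq_one_iff.mp hdet with rfl | rfl
    · apply h1
      rw [← map_one Matrix.SpecialLinearGroup.toGL]
      congr 1
      ext i j
      fin_cases i <;> fin_cases j <;> simp [h00, h01, h10, h11]
    · apply h2
      rw [← map_one Matrix.SpecialLinearGroup.toGL, ← toGL_neg]
      congr 1
      ext i j
      fin_cases i <;> fin_cases j <;> simp [h00, h01, h10, h11, Matrix.SpecialLinearGroup.coe_neg]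
  · show Matrix.discr ((Matrix.SpecialLinearGroup.toGL g : GL (Fin 2) ℝ) : Matrix (Fin 2) (Fin 2) ℝ) = 0
    rw [Matrix.discr_fin_two, Matrix.trace_fin_two, Matrix.det_fin_two]
    show (g 0 0 + g 1 1) ^ 2 - 4 * (g 0 0 * g 1 1 - g 0 1 * g 1 0) = 0
    rw [hdet, htr]; ring

/-- **A parabolic element with small displacement puts the point high in a cusp.** Given a
complete system of inequivalent cusps `𝔞_i = σ_i ∞` with `σ_i⁻¹Γ_{𝔞_i}σ_i = {±T^n}`, if `γ ∈ Γ`,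
`γ ≠ ±1`, `tr²γ = 4` and `u(z, γz) < 1/4`, then `δz ∈ σ_i{Im > 1}` for some `δ ∈ Γ` and `i`
(`γ` fixes a cusp `δ₀𝔞_i`; in the frame, `γ` is `±T^n`, `n ≠ 0`, moving `z''` by `n²/4y''²`).
[cite: Iwaniec2002, §2.2 (2.1)–(2.5), PDF pp. 30–31] -/
theorem exists_smul_mem_cusp_of_parabolic
    (hΓ : Γ ≤ (Matrix.SpecialLinearGroup.toGL : SL(2, ℝ) →* GL (Fin 2) ℝ).range)
    (hneg : -1 ∈ Γ) (hd : IsDiscreteSubgroup Γ) {h : ℕ} {𝔞 : Fin h → OnePoint ℝ} {σ : Fin h → SL(2, ℝ)}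
    (hinfty : ∀ i, (Matrix.SpecialLinearGroup.toGL (σ i) : GL (Fin 2) ℝ) • (OnePoint.infty : OnePoint ℝ) = 𝔞 i)
    (hper : ∀ i, (ConjAct.toConjAct (Matrix.SpecialLinearGroup.toGL (σ i) : GL (Fin 2) ℝ)⁻¹ • Γ).strictPeriods =
      AddSubgroup.zmultiples 1)
    (hcomplete : ∀ c : OnePoint ℝ, IsCusp c Γ → ∃ i, ∃ γ ∈ Γ, γ • 𝔞 i = c)
    {γ : GL (Fin 2) ℝ} (hγ : γ ∈ Γ) (h1 : γ ≠ 1) (h2 : γ ≠ -1) (htr : ((γ 0 0 : ℝ) + γ 1 1) ^ 2 = 4)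
    {z : ℍ} (hu : pointPairInv z (γ • z) < 1 / 4) :
    ∃ δ ∈ Γ, ∃ i, δ • z ∈ (Matrix.SpecialLinearGroup.toGL (σ i) : GL (Fin 2) ℝ) • {w : ℍ | 1 < w.im} := by
  have ee : ∀ (x : SL(2, ℝ)) (z : ℍ), (Matrix.SpecialLinearGroup.toGL x : GL (Fin 2) ℝ) • z = x • z :=
    fun x z => rfl
  have hpar := isParabolic_of_traceSq_eq_four (hΓ hγ) h1 h2 htr
  set c := Matrix.GeneralLinearGroup.parabolicFixedPoint γ with hc
  have hγc : γ • c = c := (hpar.smul_eq_self_iff).mpr rfl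
  have hcusp : IsCusp c Γ := ⟨γ, hγ, hpar, hγc⟩
  obtain ⟨i, δ₀, hδ₀, hδ₀c⟩ := hcomplete c hcusp
  -- `η' = δ₀⁻¹ γ δ₀` fixes `𝔞 i`
  set η' : GL (Fin 2) ℝ := δ₀⁻¹ * γ * δ₀ with hη'
  have hη'mem : η' ∈ Γ := Γ.mul_mem (Γ.mul_mem (Γ.inv_mem hδ₀) hγ) hδ₀
  have hη'fix : η' • 𝔞 i = 𝔞 i := by
    rw [hη', mul_smul, mul_smul, hδ₀c, hγc, ← hδ₀c, inv_smul_smul]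
  obtain ⟨n, hn⟩ := conj_eq_upperRightHom_of_smul_eq hΓ hneg hd (hinfty i) (hper i) hη'mem hη'fix
  set S : GL (Fin 2) ℝ := Matrix.SpecialLinearGroup.toGL (σ i) with hS
  -- `n ≠ 0`
  have hn0 : n ≠ 0 := by
    rintro rfl
    simp only [Int.cast_zero] at hn
    rw [show (0 : ℝ) = ((0 : ℝ)) from rfl] at hn
    have h0 : Matrix.GeneralLinearGroup.upperRightHom (0 : ℝ) = 1 := by
      rw [← toGL_translSL]; rw [show translSL 0 = 1 by ext i j; fin_cases i <;> fin_cases j <;> simp, map_one]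
    rw [h0] at hn
    have hγeq : γ = δ₀ * (S * (S⁻¹ * η' * S) * S⁻¹) * δ₀⁻¹ := by rw [hη']; group
    rcases hn with h | h
    · apply h1; rw [hγeq, h]; group
    · apply h2; rw [hγeq, h]; simp
  -- the frame point `z'' = S⁻¹ δ₀⁻¹ z`
  set z'' : ℍ := S⁻¹ • δ₀⁻¹ • z with hz''
  have hdisp : pointPairInv z (γ • z) = (n : ℝ) ^ 2 / (4 * z''.im ^ 2) := by
    obtain ⟨d₀, hd₀⟩ := hΓ hδ₀
    have hγz : γ • z = (δ₀ * S) • (S⁻¹ * η' * S) • z'' := by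
      rw [hz'', hη']
      simp only [mul_smul, smul_inv_smul]
    have hz : z = (δ₀ * S) • z'' := by rw [hz'', mul_smul, smul_inv_smul, smul_inv_smul]
    have hiso : pointPairInv ((δ₀ * S) • z'') ((δ₀ * S) • (S⁻¹ * η' * S) • z'') =
        pointPairInv z'' ((S⁻¹ * η' * S) • z'') := by
      rw [← hd₀, hS, ← map_mul, ee, ee, pointPairInv_smul]
    rw [hγz]
    conv_lhs => rw [hz]
    rw [hiso]
    rcases hn with h | h
    · rw [h, upperRightHom_smul, pointPairInv_vadd]
    · rw [h, UpperHalfPlane.neg_smul, upperRightHom_smul, pointPairInv_vadd]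
  rw [hdisp] at hu
  have hn1 : (1 : ℝ) ≤ (n : ℝ) ^ 2 := by
    have : (1 : ℤ) ≤ n ^ 2 := by nlinarith [sq_pos_of_ne_zero hn0]
    exact_mod_cast this
  have hy : 0 < z''.im := z''.im_pos
  have hy1 : 1 < z''.im := by
    rw [div_lt_iff₀ (by positivity)] at hu
    nlinarith
  refine ⟨δ₀⁻¹, Γ.inv_mem hδ₀, i, ⟨z'', hy1, ?_⟩⟩
  show S • z'' = δ₀⁻¹ • z
  rw [hz'', smul_inv_smul]

end Displacement

/-! ## 2. The thick part: bounded local multiplicity -/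

section Thick

/-- A point is **thick** (relative to the threshold `1/4`) if every parabolic element of `Γ` moves
it by `u ≥ 1/4`. [cite: Iwaniec2002, §2.2 (2.5), PDF p. 31] -/
def IsThick (Γ : Subgroup (GL (Fin 2) ℝ)) (z : ℍ) : Prop :=
  ∀ γ ∈ Γ, γ ≠ 1 → γ ≠ -1 → ((γ 0 0 : ℝ) + γ 1 1) ^ 2 = 4 → 1 / 4 ≤ pointPairInv z (γ • z)

/-- The admissible radius `ρ` for the local analysis: `ρ < 1/4`, `ρ < η/4` and
`4δ'(1 + δ') < η/4` for `δ' = 4ρ(1+ρ)`. [folklore] -/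
def IsAdmissibleRadius (η ρ : ℝ) : Prop :=
  0 < ρ ∧ ρ < 1 / 4 ∧ ρ < η / 4 ∧ 4 * (4 * ρ * (1 + ρ)) * (1 + 4 * ρ * (1 + ρ)) < η / 4

/-- `ρ = min(1/8, η/1200)` is admissible. [folklore] -/
theorem isAdmissibleRadius_min {η : ℝ} (hη : 0 < η) : IsAdmissibleRadius η (min (1 / 8) (η / 1200)) := by
  set ρ := min (1 / 8) (η / 1200) with hρ
  have h1 : ρ ≤ 1 / 8 := min_le_left _ _
  have h2 : ρ ≤ η / 1200 := min_le_right _ _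
  have h0 : 0 < ρ := lt_min (by norm_num) (by positivity)
  refine ⟨h0, by linarith, by linarith, ?_⟩
  have h3 : 4 * ρ * (1 + ρ) ≤ 5 * ρ := by nlinarith
  have h4 : 4 * (4 * ρ * (1 + ρ)) * (1 + 4 * ρ * (1 + ρ)) ≤ 4 * (5 * ρ) * (1 + 5 * ρ) := by
    have : 0 ≤ 4 * ρ * (1 + ρ) := by positivity
    nlinarith
  nlinarith

/-- **Bounded local multiplicity in the thick part.** If `#Γ_p ≤ M` for all `p`, `Γ` has systole
`η`, `z` is thick and `ρ` is admissible, then the elements of `Γ` moving `z` by `u ≤ ρ` all lie in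
one stabiliser `Γ_p` (they are `±1` or elliptic with a common fixed point), so there are at most
`M` of them. [cite: Iwaniec2002, §2.2 (Prop. 2.3), PDF pp. 28–29] -/
theorem small_displacement_subset_stabiliser
    (hΓ : Γ ≤ (Matrix.SpecialLinearGroup.toGL : SL(2, ℝ) →* GL (Fin 2) ℝ).range)
    (hd : IsDiscreteSubgroup Γ) {η ρ : ℝ}
    (hη : ∀ γ ∈ Γ, 4 < ((γ 0 0 : ℝ) + γ 1 1) ^ 2 → η ≤ ((γ 0 0 : ℝ) + γ 1 1) ^ 2 - 4)
    (hρ : IsAdmissibleRadius η ρ) {z : ℍ} (hz : IsThick Γ z) :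
    ∃ p : ℍ, {γ : GL (Fin 2) ℝ | γ ∈ Γ ∧ pointPairInv z (γ • z) ≤ ρ} ⊆ stabiliser Γ p := by
  obtain ⟨hρ0, hρ1, hρ2, hρ3⟩ := hρ
  have ee : ∀ (x : SL(2, ℝ)) (z : ℍ), (Matrix.SpecialLinearGroup.toGL x : GL (Fin 2) ℝ) • z = x • z :=
    fun x z => rfl
  -- classification of an element with small displacement: `±1` or elliptic
  have hclass : ∀ γ : GL (Fin 2) ℝ, γ ∈ Γ → pointPairInv z (γ • z) ≤ ρ → γ ≠ 1 → γ ≠ -1 →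
      ∃ A : SL(2, ℝ), (Matrix.SpecialLinearGroup.toGL A : GL (Fin 2) ℝ) = γ ∧ (A 0 0 + A 1 1) ^ 2 < 4 := by
    intro γ hγ hu h1 h2
    obtain ⟨A, rfl⟩ := hΓ hγ
    refine ⟨A, rfl, ?_⟩
    have eA : ∀ i j, ((Matrix.SpecialLinearGroup.toGL A : GL (Fin 2) ℝ) i j : ℝ) = A i j := fun i j => rfl
    rcases lt_trichotomy ((A 0 0 + A 1 1) ^ 2) 4 with h | h | h
    · exact h
    · exfalso
      have := hz _ hγ h1 h2 (by simp only [eA]; exact h)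
      linarith
    · exfalso
      have h' := hη _ hγ (by simp only [eA]; exact h)
      simp only [eA] at h'
      have := traceSq_sub_four_le_pointPairInv A h z
      rw [ee] at hu
      linarith
  by_cases hex : ∃ γ : GL (Fin 2) ℝ, γ ∈ Γ ∧ pointPairInv z (γ • z) ≤ ρ ∧ γ ≠ 1 ∧ γ ≠ -1
  · obtain ⟨γ₀, hγ₀, hu₀, h1, h2⟩ := hex
    obtain ⟨A₀, hA₀, hA₀tr⟩ := hclass γ₀ hγ₀ hu₀ h1 h2
    obtain ⟨p₀, hp₀⟩ := exists_smul_eq_self_of_traceSq_lt_four A₀ hA₀tr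
    refine ⟨p₀, ?_⟩
    rintro γ ⟨hγ, hu⟩
    refine ⟨hγ, ?_⟩
    by_cases h1' : γ = 1
    · rw [h1', one_smul]
    by_cases h2' : γ = -1
    · rw [h2', UpperHalfPlane.neg_smul, one_smul]
    obtain ⟨A, rfl, hAtr⟩ := hclass γ hγ hu h1' h2'
    obtain ⟨p, hp⟩ := exists_smul_eq_self_of_traceSq_lt_four A hAtr
    -- the two fixed points agree
    have hA1 : A ≠ 1 := fun h => h1' (by rw [h, map_one])
    have hA2 : A ≠ -1 := fun h => h2' (by rw [h, toGL_neg, map_one])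
    have hA₀1 : A₀ ≠ 1 := fun h => h1 (by rw [← hA₀, h, map_one])
    have hA₀2 : A₀ ≠ -1 := fun h => h2 (by rw [← hA₀, h, toGL_neg, map_one])
    rw [← hA₀] at hγ₀ hu₀
    have key := fixedPoint_eq_of_small_displacement hΓ hd hη hγ hγ₀ (p₁ := p) (p₂ := p₀)
      (by rw [ee]; exact hp) (by rw [ee]; exact hp₀) hA1 hA2 hA₀1 hA₀2 hρ0.le hu hu₀ hρ3
    rw [key] at hp
    rw [ee]
    exact hp
  · -- only `±1`
    refine ⟨z, ?_⟩
    rintro γ ⟨hγ, hu⟩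
    refine ⟨hγ, ?_⟩
    by_contra hne
    apply hex
    refine ⟨γ, hγ, hu, ?_, ?_⟩
    · rintro rfl; exact hne (one_smul _ _)
    · rintro rfl; exact hne (by rw [UpperHalfPlane.neg_smul, one_smul])

/-- Hence at most `M` elements move a thick point by `u ≤ ρ`. [cite: Iwaniec2002, §2.2 (Prop. 2.3), PDF pp. 28–29] -/
theorem ncard_small_displacement_le
    (hΓ : Γ ≤ (Matrix.SpecialLinearGroup.toGL : SL(2, ℝ) →* GL (Fin 2) ℝ).range)
    (hd : IsDiscreteSubgroup Γ) {M : ℕ} (hM : ∀ p : ℍ, (stabiliser Γ p).ncard ≤ M) {η ρ : ℝ}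
    (hη : ∀ γ ∈ Γ, 4 < ((γ 0 0 : ℝ) + γ 1 1) ^ 2 → η ≤ ((γ 0 0 : ℝ) + γ 1 1) ^ 2 - 4)
    (hρ : IsAdmissibleRadius η ρ) {z : ℍ} (hz : IsThick Γ z) :
    {γ : GL (Fin 2) ℝ | γ ∈ Γ ∧ pointPairInv z (γ • z) ≤ ρ}.Finite ∧
      {γ : GL (Fin 2) ℝ | γ ∈ Γ ∧ pointPairInv z (γ • z) ≤ ρ}.ncard ≤ M := by
  obtain ⟨p, hp⟩ := small_displacement_subset_stabiliser hΓ hd hη hρ hz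
  have hfin := finite_stabiliser hΓ hd p
  exact ⟨hfin.subset hp, (Set.ncard_le_ncard hp hfin).trans (hM p)⟩

end Thick

/-! ## 3. Packing separated thick points -/

section Packing

variable {N : ℕ} {pt : Fin N → ℍ}

/-- The unfolding weight `Σ_i M⁻¹ 𝟙_{B(p_i, r)}`. [folklore] -/
def thickWeight (M : ℕ) (pt : Fin N → ℍ) (r : ℝ) (z : ℍ) : ℝ≥0∞ :=
  ∑ i, (uDisc (pt i) r).indicator (fun _ => ((M : ℝ≥0∞))⁻¹) z

/-- The weight is measurable. [folklore] -/
theorem measurable_thickWeight (M : ℕ) (pt : Fin N → ℍ) {r : ℝ} (hr : 0 ≤ r) :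
    Measurable (thickWeight M pt r) := by
  refine Finset.measurable_sum _ fun i _ => ?_
  exact measurable_const.indicator (measurableSet_uDisc hr)

/-- **Multiplicity at most one** for the discs of radius `r`, `4r(1+r) ≤ ρ`, about pairwise
`ρ`-separated thick points (`u(γ p_i, p_j) > ρ` for `i ≠ j`, all `γ`): all hits at `w` are in one
class `i₀` and come from a coset of the `≤ M` elements moving `p_{i₀}` by `≤ ρ`.
[cite: Iwaniec2002, §2.2 (Prop. 2.3), PDF pp. 28–29] -/
theorem tsum_thickWeight_le_one
    (hΓ : Γ ≤ (Matrix.SpecialLinearGroup.toGL : SL(2, ℝ) →* GL (Fin 2) ℝ).range)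
    (hd : IsDiscreteSubgroup Γ) {M : ℕ} (hM : ∀ p : ℍ, (stabiliser Γ p).ncard ≤ M) {η ρ r : ℝ}
    (hη : ∀ γ ∈ Γ, 4 < ((γ 0 0 : ℝ) + γ 1 1) ^ 2 → η ≤ ((γ 0 0 : ℝ) + γ 1 1) ^ 2 - 4)
    (hρ : IsAdmissibleRadius η ρ) (hr : 0 ≤ r) (hrρ : 4 * r * (1 + r) ≤ ρ)
    (hthick : ∀ i, IsThick Γ (pt i))
    (hsep : ∀ i j, i ≠ j → ∀ γ ∈ Γ, ρ < pointPairInv (γ • pt i) (pt j)) (w : ℍ) :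
    (∑' γ : Γ, thickWeight M pt r ((γ : GL (Fin 2) ℝ) • w)) ≤ 1 := by
  classical
  by_cases hex : ∃ (γ : Γ) (i : Fin N), (γ : GL (Fin 2) ℝ) • w ∈ uDisc (pt i) r
  · obtain ⟨γ₀, i₀, h₀⟩ := hex
    set S : Set (GL (Fin 2) ℝ) := {γ | γ ∈ Γ ∧ pointPairInv (pt i₀) (γ • pt i₀) ≤ ρ} with hS
    obtain ⟨hSfin, hScard⟩ := ncard_small_displacement_le hΓ hd hM hη hρ (hthick i₀)
    -- every hit is in the class `i₀` and in the coset `S γ₀`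
    have hcl : ∀ (γ : Γ) (i : Fin N), (γ : GL (Fin 2) ℝ) • w ∈ uDisc (pt i) r →
        i = i₀ ∧ ((γ : GL (Fin 2) ℝ) * (γ₀ : GL (Fin 2) ℝ)⁻¹) ∈ S := by
      intro γ i hγ
      set θ : GL (Fin 2) ℝ := (γ : GL (Fin 2) ℝ) * (γ₀ : GL (Fin 2) ℝ)⁻¹ with hθ
      have hθmem : θ ∈ Γ := Γ.mul_mem γ.2 (Γ.inv_mem γ₀.2)
      obtain ⟨t, ht⟩ := hΓ hθmem
      have ee : ∀ (x : SL(2, ℝ)) (z : ℍ), (Matrix.SpecialLinearGroup.toGL x : GL (Fin 2) ℝ) • z = x • z :=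
        fun x z => rfl
      have hθw : θ • ((γ₀ : GL (Fin 2) ℝ) • w) = (γ : GL (Fin 2) ℝ) • w := by rw [hθ, mul_smul, inv_smul_smul]
      -- `u(p_i, θ p_{i₀}) ≤ 4r(1+r) ≤ ρ`
      have h1 : pointPairInv ((γ : GL (Fin 2) ℝ) • w) (pt i) ≤ r := by rw [pointPairInv_comm]; exact hγ
      have h2 : pointPairInv ((γ : GL (Fin 2) ℝ) • w) (θ • pt i₀) ≤ r := by
        rw [← hθw, ← ht, ee, ee, pointPairInv_smul, pointPairInv_comm]; exact h₀
      have hnear : pointPairInv (θ • pt i₀) (pt i) ≤ ρ := by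
        have := pointPairInv_le_of_le_of_le hr h1 h2
        rw [pointPairInv_comm] at this
        exact this.trans hrρ
      have hi : i = i₀ := by
        by_contra hne
        exact absurd hnear (not_le.mpr (hsep i₀ i (Ne.symm hne) θ hθmem))
      subst hi
      refine ⟨rfl, hθmem, ?_⟩
      rw [pointPairInv_comm]; exact hnear
    -- the support
    set T : Set Γ := {γ | ((γ : GL (Fin 2) ℝ) * (γ₀ : GL (Fin 2) ℝ)⁻¹) ∈ S} with hT
    have hinj : Set.InjOn (fun γ : Γ => (γ : GL (Fin 2) ℝ) * (γ₀ : GL (Fin 2) ℝ)⁻¹) T :=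
      fun a _ b _ h => Subtype.ext (mul_right_cancel h)
    have hTfin : T.Finite :=
      hSfin.preimage (f := fun γ : Γ => (γ : GL (Fin 2) ℝ) * (γ₀ : GL (Fin 2) ℝ)⁻¹) hinj
    have hTcard : T.ncard ≤ M :=
      (Set.ncard_le_ncard_of_injOn (fun γ : Γ => (γ : GL (Fin 2) ℝ) * (γ₀ : GL (Fin 2) ℝ)⁻¹)
        (fun γ hγ => hγ) hinj hSfin).trans hScard
    set c : ℝ≥0∞ := ((M : ℝ≥0∞))⁻¹ with hc
    have hM0 : (M : ℝ≥0∞) ≠ 0 := by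
      have : 0 < M := by
        have h1 := hM (pt i₀)
        have h2 : 0 < (stabiliser Γ (pt i₀)).ncard :=
          (Set.ncard_pos (finite_stabiliser hΓ hd (pt i₀))).mpr ⟨1, one_mem_stabiliser (pt i₀)⟩
        omega
      exact_mod_cast this.ne'
    have hφ : ∀ γ : Γ, thickWeight M pt r ((γ : GL (Fin 2) ℝ) • w) ≤ T.indicator (fun _ => c) γ := by
      intro γ
      by_cases hT' : γ ∈ T
      · rw [Set.indicator_of_mem hT']
        unfold thickWeight
        calc ∑ i, (uDisc (pt i) r).indicator (fun _ => ((M : ℝ≥0∞))⁻¹) ((γ : GL (Fin 2) ℝ) • w)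
            ≤ ∑ i, (if i = i₀ then c else 0) := by
              refine Finset.sum_le_sum fun i _ => ?_
              by_cases hmem : (γ : GL (Fin 2) ℝ) • w ∈ uDisc (pt i) r
              · obtain ⟨rfl, -⟩ := hcl γ i hmem
                rw [Set.indicator_of_mem hmem, if_pos rfl]
              · rw [Set.indicator_of_notMem hmem]
                exact bot_le
          _ = c := by rw [Finset.sum_ite_eq' Finset.univ i₀ (fun _ => c)]; simp
      · rw [Set.indicator_of_notMem hT']
        unfold thickWeight
        apply le_of_eq
        refine Finset.sum_eq_zero fun i _ => ?_
        rw [Set.indicator_apply_eq_zero]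
        intro hmem
        exact absurd (hcl γ i hmem).2 hT'
    calc (∑' γ : Γ, thickWeight M pt r ((γ : GL (Fin 2) ℝ) • w)) ≤ ∑' γ : Γ, T.indicator (fun _ => c) γ :=
          ENNReal.tsum_le_tsum hφ
      _ = ∑' _ : T, c := (tsum_subtype T fun _ => c).symm
      _ = T.encard * c := ENNReal.tsum_set_const _ _
      _ ≤ (M : ℝ≥0∞) * c := by
          gcongr
          rw [← hTfin.cast_ncard_eq]
          exact_mod_cast hTcard
      _ = 1 := ENNReal.mul_inv_cancel hM0 (ENNReal.natCast_ne_top _)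
  · push Not at hex
    have : ∀ γ : Γ, thickWeight M pt r ((γ : GL (Fin 2) ℝ) • w) = 0 := by
      intro γ
      unfold thickWeight
      refine Finset.sum_eq_zero fun i _ => ?_
      exact Set.indicator_of_notMem (hex γ i) _
    simp [this]

/-- **Packing bound**: a family of `N` pairwise `ρ`-separated thick points has
`2N · 4πr ≤ M |F|`. [cite: Iwaniec2002, §2.2 (Prop. 2.3), PDF pp. 28–29] -/
theorem card_separated_le
    (hΓ : Γ ≤ (Matrix.SpecialLinearGroup.toGL : SL(2, ℝ) →* GL (Fin 2) ℝ).range)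
    (hneg : -1 ∈ Γ) (hd : IsDiscreteSubgroup Γ) (hF : IsHypFundamentalDomain Γ F)
    {M : ℕ} (hM : ∀ p : ℍ, (stabiliser Γ p).ncard ≤ M) {η ρ r : ℝ}
    (hη : ∀ γ ∈ Γ, 4 < ((γ 0 0 : ℝ) + γ 1 1) ^ 2 → η ≤ ((γ 0 0 : ℝ) + γ 1 1) ^ 2 - 4)
    (hρ : IsAdmissibleRadius η ρ) (hr : 0 ≤ r) (hrρ : 4 * r * (1 + r) ≤ ρ)
    (hthick : ∀ i, IsThick Γ (pt i))
    (hsep : ∀ i j, i ≠ j → ∀ γ ∈ Γ, ρ < pointPairInv (γ • pt i) (pt j)) :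
    2 * ((N : ℝ≥0∞) * ENNReal.ofReal (4 * π * r)) ≤ (M : ℝ≥0∞) * volume F := by
  set φ := thickWeight M pt r with hφ
  have hφm : AEMeasurable φ := (measurable_thickWeight M pt hr).aemeasurable
  have key := setLIntegral_tsum_smul_eq hΓ hneg hd.countable hF hφm
  have hmass : ∫⁻ z, φ z = ((M : ℝ≥0∞))⁻¹ * ((N : ℝ≥0∞) * ENNReal.ofReal (4 * π * r)) := by
    rw [hφ]
    unfold thickWeight
    rw [lintegral_finsetSum _ fun i _ => (measurable_const.indicator (measurableSet_uDisc hr))]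
    simp_rw [lintegral_indicator_const (measurableSet_uDisc hr), volume_uDisc hr]
    simp [mul_comm, mul_left_comm]
  have hle : ∫⁻ w in F, ∑' γ : Γ, φ ((γ : GL (Fin 2) ℝ) • w) ≤ volume F := by
    calc ∫⁻ w in F, ∑' γ : Γ, φ ((γ : GL (Fin 2) ℝ) • w) ≤ ∫⁻ _w in F, (1 : ℝ≥0∞) :=
          lintegral_mono fun w => tsum_thickWeight_le_one hΓ hd hM hη hρ hr hrρ hthick hsep w
      _ = volume F := setLIntegral_one F
  rw [key, hmass] at hle
  have hMpos : 0 < M := by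
    have h1 := hM I
    have h2 : 0 < (stabiliser Γ I).ncard :=
      (Set.ncard_pos (finite_stabiliser hΓ hd I)).mpr ⟨1, one_mem_stabiliser I⟩
    omega
  have hM0 : (M : ℝ≥0∞) ≠ 0 := by exact_mod_cast hMpos.ne'
  calc 2 * ((N : ℝ≥0∞) * ENNReal.ofReal (4 * π * r))
      = (M : ℝ≥0∞) * ((M : ℝ≥0∞))⁻¹ * (2 * ((N : ℝ≥0∞) * ENNReal.ofReal (4 * π * r))) := by
        rw [ENNReal.mul_inv_cancel hM0 (ENNReal.natCast_ne_top _), one_mul]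
    _ = (M : ℝ≥0∞) * (2 * (((M : ℝ≥0∞))⁻¹ * ((N : ℝ≥0∞) * ENNReal.ofReal (4 * π * r)))) := by ring
    _ ≤ (M : ℝ≥0∞) * volume F := mul_le_mul_right hle _

end Packing

/-! ## 4. The compact core -/

section Core

/-- **The compact core (Siegel's theorem in thick–thin form).** Let `Γ ≤ SL₂(ℝ)` (inside `GL₂(ℝ)`)
be discrete with `-1 ∈ Γ` and a measurable fundamental domain of finite hyperbolic area, and let
`𝔞_i = σ_i∞` be a complete system of inequivalent cusps with `σ_i⁻¹Γ_{𝔞_i}σ_i = {±Tⁿ}`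
(`FuchsianCuspZones.exists_cuspSystem`). Then there is a compact `K ⊂ ℍ` such that every `z ∈ ℍ` has
a `Γ`-translate in `K` or in a cuspidal region `σ_i{Im z > 1}` — Iwaniec's partition (2.5)
`F = F(Y) ∪ ⋃_𝔞 F_𝔞(Y)` with `F(Y)` of compact closure, i.e. `Γ` is of the first kind with a
fundamental polygon all of whose ends are cusps (Prop. 2.3–2.5). Proof: a point moved little by a
parabolic element is high in a cusp (`exists_smul_mem_cusp_of_parabolic`); the remaining (thick)
points have local multiplicity `≤ M` (`FuchsianTorsion` and the positive systole of
`FuchsianCollars`, via `small_displacement_subset_stabiliser`), so a maximal `ρ`-separated family of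
thick points is finite by unfolding (`card_separated_le`) and its `ρ`-discs cover the thick part
modulo `Γ`. [cite: Iwaniec2002, §2.2 (Prop. 2.3–2.5, (2.5)), PDF pp. 28–31] -/
theorem exists_compact_core
    (hΓ : Γ ≤ (Matrix.SpecialLinearGroup.toGL : SL(2, ℝ) →* GL (Fin 2) ℝ).range)
    (hneg : -1 ∈ Γ) (hd : IsDiscreteSubgroup Γ) (hF : IsHypFundamentalDomain Γ F) (hvol : volume F < ⊤)
    {h : ℕ} {𝔞 : Fin h → OnePoint ℝ} {σ : Fin h → SL(2, ℝ)}
    (hinfty : ∀ i, (Matrix.SpecialLinearGroup.toGL (σ i) : GL (Fin 2) ℝ) • (OnePoint.infty : OnePoint ℝ) = 𝔞 i)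
    (hper : ∀ i, (ConjAct.toConjAct (Matrix.SpecialLinearGroup.toGL (σ i) : GL (Fin 2) ℝ)⁻¹ • Γ).strictPeriods =
      AddSubgroup.zmultiples 1)
    (hcomplete : ∀ c : OnePoint ℝ, IsCusp c Γ → ∃ i, ∃ γ ∈ Γ, γ • 𝔞 i = c) :
    ∃ K : Set ℍ, IsCompact K ∧ ∀ z : ℍ, ∃ γ ∈ Γ,
      γ • z ∈ K ∨ ∃ i, γ • z ∈ (Matrix.SpecialLinearGroup.toGL (σ i) : GL (Fin 2) ℝ) • {w : ℍ | 1 < w.im} := by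
  classical
  obtain ⟨M, hM⟩ := exists_stabiliser_ncard_le hΓ hneg hd hF hvol
  obtain ⟨η, hη0, hη⟩ := exists_pos_le_traceSq_sub_four hΓ hneg hd hF hvol
  set ρ : ℝ := min (1 / 8) (η / 1200) with hρdef
  have hρ : IsAdmissibleRadius η ρ := isAdmissibleRadius_min hη0
  have hρ0 : 0 < ρ := hρ.1
  have hρ8 : ρ ≤ 1 / 8 := min_le_left _ _
  set r : ℝ := ρ / 8 with hrdef
  have hr : 0 ≤ r := by positivity
  have hr0 : 0 < r := by positivity
  have hrρ : 4 * r * (1 + r) ≤ ρ := by rw [hrdef]; nlinarith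
  -- separated thick families and their size bound
  set P : ℕ → Prop := fun n => ∃ pt : Fin n → ℍ, (∀ i, IsThick Γ (pt i)) ∧
    ∀ i j, i ≠ j → ∀ γ ∈ Γ, ρ < pointPairInv (γ • pt i) (pt j) with hP
  set c : ℝ := 4 * π * r with hc
  have hc0 : 0 < c := by positivity
  set B : ℕ := ⌊(M : ℝ) * (volume F).toReal / (2 * c)⌋₊ with hB
  have hbound : ∀ n, P n → n ≤ B := by
    rintro n ⟨pt, hthick, hsep⟩
    have hle := card_separated_le hΓ hneg hd hF hM hη hρ hr hrρ hthick hsep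
    have hle' : 2 * ((n : ℝ) * c) ≤ M * (volume F).toReal := by
      have hfin : (M : ℝ≥0∞) * volume F ≠ ⊤ := ENNReal.mul_ne_top (ENNReal.natCast_ne_top _) hvol.ne
      have := ENNReal.toReal_mono hfin hle
      rw [ENNReal.toReal_mul, ENNReal.toReal_mul, ENNReal.toReal_mul, ENNReal.toReal_ofReal hc0.le] at this
      simpa using this
    rw [hB]
    apply Nat.le_floor
    rw [le_div_iff₀ (by positivity)]
    linarith
  have hP0 : P 0 := ⟨Fin.elim0, fun i => Fin.elim0 i, fun i => Fin.elim0 i⟩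
  set n₀ : ℕ := Nat.findGreatest P B with hn₀
  have hPn₀ : P n₀ := Nat.findGreatest_spec (Nat.zero_le B) hP0
  have hmax : ∀ k, P k → k ≤ n₀ := by
    intro k hk
    by_contra hlt
    push Not at hlt
    exact Nat.findGreatest_is_greatest hlt (hbound k hk) hk
  obtain ⟨pt, hthick, hsep⟩ := hPn₀
  -- the compact core
  refine ⟨⋃ i : Fin n₀, uDisc (pt i) ρ, ?_, ?_⟩
  · refine isCompact_iUnion fun i => ?_
    rw [uDisc_eq_closedBall hρ0.le]
    exact isCompact_closedBall _ _
  intro z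
  by_cases hz : IsThick Γ z
  · -- a thick point is `ρ`-close to the family modulo `Γ`, by maximality
    by_contra hno
    push Not at hno
    have hfar : ∀ γ ∈ Γ, ∀ i, ρ < pointPairInv (pt i) (γ • z) := by
      intro γ hγ i
      have := (hno γ hγ).1
      rw [Set.mem_iUnion] at this
      push Not at this
      exact not_le.mp (fun hle => this i hle)
    -- extend the family by `z`
    have hP' : P (n₀ + 1) := by
      refine ⟨Fin.cons z pt, ?_, ?_⟩
      · intro i
        refine Fin.cases ?_ (fun j => ?_) i
        · simpa using hz
        · simpa using hthick j
      · have ee : ∀ (x : SL(2, ℝ)) (w : ℍ), (Matrix.SpecialLinearGroup.toGL x : GL (Fin 2) ℝ) • w = x • w :=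
          fun x w => rfl
        intro i j hij γ hγ
        rcases Fin.eq_zero_or_eq_succ i with rfl | ⟨i', rfl⟩ <;>
          rcases Fin.eq_zero_or_eq_succ j with rfl | ⟨j', rfl⟩
        · exact absurd rfl hij
        · simp only [Fin.cons_zero, Fin.cons_succ]
          rw [pointPairInv_comm]
          exact hfar γ hγ j'
        · simp only [Fin.cons_zero, Fin.cons_succ]
          have hfar' := hfar γ⁻¹ (Γ.inv_mem hγ) i'
          obtain ⟨g, rfl⟩ := hΓ hγ
          rw [← map_inv, ee] at hfar'
          rw [ee]
          calc ρ < pointPairInv (pt i') (g⁻¹ • z) := hfar'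
            _ = pointPairInv (g⁻¹ • g • pt i') (g⁻¹ • z) := by rw [inv_smul_smul]
            _ = pointPairInv (g • pt i') z := pointPairInv_smul _ _ _
        · simp only [Fin.cons_succ]
          exact hsep i' j' (fun h => hij (by rw [h])) γ hγ
    have := hmax _ hP'
    omega
  · -- a thin point is high in a cusp
    unfold IsThick at hz
    push Not at hz
    obtain ⟨γ, hγ, h1, h2, htr, hu⟩ := hz
    obtain ⟨δ, hδ, i, hi⟩ := exists_smul_mem_cusp_of_parabolic hΓ hneg hd hinfty hper hcomplete hγ h1 h2 htr hu
    exact ⟨δ, hδ, Or.inr ⟨i, hi⟩⟩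

/-- **Siegel's theorem packaged with the cusp system** (Iwaniec's Prop. 2.3–2.5 for a finite
volume group): a complete system of `h ≤ |F|` inequivalent cusps `𝔞_i = σ_i∞` with
`σ_i⁻¹Γ_{𝔞_i}σ_i = {±Tⁿ}`, and a compact `K` with `ℍ = ΓK ∪ ⋃_i Γσ_i{Im z > 1}`.
[cite: Iwaniec2002, §2.2 (Prop. 2.3–2.5, (2.1)–(2.5)), PDF pp. 28–31] -/
theorem exists_cuspSystem_and_compact_core
    (hΓ : Γ ≤ (Matrix.SpecialLinearGroup.toGL : SL(2, ℝ) →* GL (Fin 2) ℝ).range)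
    (hneg : -1 ∈ Γ) (hd : IsDiscreteSubgroup Γ) (hF : IsHypFundamentalDomain Γ F) (hvol : volume F < ⊤) :
    ∃ (h : ℕ) (𝔞 : Fin h → OnePoint ℝ) (σ : Fin h → SL(2, ℝ)) (K : Set ℍ),
      (h : ℝ≥0∞) ≤ volume F ∧
      (∀ i, (Matrix.SpecialLinearGroup.toGL (σ i) : GL (Fin 2) ℝ) • (OnePoint.infty : OnePoint ℝ) = 𝔞 i) ∧
      (∀ i, (ConjAct.toConjAct (Matrix.SpecialLinearGroup.toGL (σ i) : GL (Fin 2) ℝ)⁻¹ • Γ).strictPeriods =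
        AddSubgroup.zmultiples 1) ∧
      (∀ i j, ∀ γ ∈ Γ, γ • 𝔞 i = 𝔞 j → i = j) ∧
      (∀ c : OnePoint ℝ, IsCusp c Γ → ∃ i, ∃ γ ∈ Γ, γ • 𝔞 i = c) ∧
      IsCompact K ∧
      ∀ z : ℍ, ∃ γ ∈ Γ, γ • z ∈ K ∨
        ∃ i, γ • z ∈ (Matrix.SpecialLinearGroup.toGL (σ i) : GL (Fin 2) ℝ) • {w : ℍ | 1 < w.im} := by
  obtain ⟨h, 𝔞, σ, hh, hinfty, hper, hineq, hcomplete⟩ := exists_cuspSystem hΓ hneg hd hF hvol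
  obtain ⟨K, hK, hcover⟩ := exists_compact_core hΓ hneg hd hF hvol hinfty hper hcomplete
  exact ⟨h, 𝔞, σ, K, hh, hinfty, hper, hineq, hcomplete, hK, hcover⟩

end Core

end Fuchsian

end Literature.NumberTheory.Automorphic

end
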